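import Summits.BirchSwinnertonDyer.BirchSwinnertonDyer.Theorems.PrintX10bUpperLinkRoad
import Summits.BirchSwinnertonDyer.BirchSwinnertonDyer.Theses.PrintX10b
import HarnessLib

/-!
# The X10b leaf `X10.BSDpOnClassX10b` from the PINNED twins A₃^pin ∧ B₃^pin and the route's bundles —
# Cha-free, J₃-free (TURNKEY T-H of plan g9's PrintX10b rev 20, kernel-certified in the tree)

HONEST FRAMING (cell `run/shared/lean/pub/bsd-print-x9/`, D-0154 KEY row 10, seat `bsd-line-x10b-p1-w2`
(gen 2) on crux stmt-BirchSwinnertonDyer-23055 `PrintX10b.BeyondCarrierDepthX10b`): THEOREMS ONLY,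
conditional glue, nothing booked, no route edited, no item closed. «beyond-print theorem»: NO. The leaf stays
conditional on the pinned twins (A₃^pin: Howard's containment for a Heegner family TIED to the frame's
parametrisation, beyond print in its μ-part at `3 ∣ h_K`; B₃^pin: the pinned two-sided transfer, print modulo
the six-input door of x10b-p3, p608225), on `AnalyticMuZeroX10b` and on the two print bundles of route
PrintX10b rev 19. BSD is not proved by any of this; no summit statement is proved by this seat.

WHAT. Plan g9's PrintX10b rev 20–23 (HOME STATUS 2026-08-28T06:57:54Z (e); Sketch
`assemblyPinnedTwinsX10b_turnkey`) replaced the J₃ crux chain {21340, 23055, 22890} of the rank-one branch by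
the pinned twins and `AssemblyPinnedTwinsX10b := A₃^pin → B₃^pin → HeegnerPrintFactsX10b →
AnalyticMuZeroX10b → PrintFactsX10b → X10.BSDpOnClassX10b` (stmt-26625, the `hAsm` of rev 23's `closes`;
CLOSED by name by this seat, p614012 `Theorems/PrintX10bAssemblyPinnedTwinsX10b.lean`, for the A₃^pin text AS
FILED). This file proves the same implication ROUTE-TEXT-FREE, with A₃^pin / B₃^pin UNFOLDED, in BOTH
A₃^pin shapes on the table — the filed one (`d_K ≠ −3`, `d_K ≠ −4`) and the LIGHT re-type asked for rev 22
(x10b-p2 LEAD 2026-08-28T07:29/08:19Z, REF-115 «recommend LIGHT re-type») — so that a re-typed assembly item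
closes by one `exact` whoever holds the seat then:
* `upperLink_of_pinnedTwins` — A₃^pin (Sketch text: `d_K ≠ −3`, `d_K ≠ −4`) and B₃^pin give the one-sided
  link U₃ (`IMC≤ ∘ BDP` at `𝟙` on tree objects) on EVERY X10b Heegner frame with odd `d_K ≠ −3`, any class
  number: instantiate A₃^pin at the frame (`d_K ≠ −4` from `Odd d_K`), feed B₃^pin, keep the `≤` half.
* `upperLink_of_pinnedTwinsLight` — the same from the LIGHT A₃^pin text of x10b-p2's TURNKEY-2 (HOME INBOX
  2026-08-28T06:58:38Z: PrintX9 rev 20a `HowardContainmentLightFramePinned` with `ClassX9 W p →` ↦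
  `ClassX10 W p → ¬ Surj W 3 → ¬ W.HasCM →`; binders `Odd d_K`, (irr_K), rank one, `Ш[p^∞]` finite).
* `bsdpOnClassX10b_of_pinnedTwins_of_printFacts`, `bsdpOnClassX10b_of_pinnedTwinsLight_of_printFacts` —
  the leaf, by `X10.bsdpOnClassX10b_of_upperLink_of_printFacts` (this seat's lineage, p608951: the proved
  assembly `printX10b_assemblyHeegner_proof` with the crux `HeegnerDivisibilityX10b` replaced by U₃; Cha 2005
  Rmk. 25, Darmon's conductor-1 datum and the derived-Heegner-point layer unused).
NUMBERS: 4 theorems, 0 definitions, 0 named facts, 0 sorry; each A₃^pin variant → leaf in ≤ 12 tactic lines.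

References: [JetchevSkinnerWan2017] Thm. 3.3.1, §7.4; [Castella2018] Thm. 2.3, §5; [YanZhu2024MainConjNonCM]
Thm. 5.7 (1), Thm. 5.9; [BurungaleCastellaSkinner2025] Prop. 4.2.2; [CastellaGrossiLeeSkinner2022] Thm. 4.1.1,
Thm. 5.1.3; [MastellaZerman2026] Cor. 4.6; route file `Theses/PrintX10b.lean` rev 19; p608951
`Theorems/PrintX10bUpperLinkRoad.lean`; p608225 `Theorems/PrintX10bTwoSidedLinkAnyClassNumberX10bOfPrintFactsPinnedLink.lean`.
-/

set_option autoImplicit false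
set_option linter.dupNamespace false

noncomputable section

open scoped Classical

open Summit.BirchSwinnertonDyer.BirchSwinnertonDyer.Theses.PrintX10b

namespace Summit.BirchSwinnertonDyer.Rank1Residual.X10

/-- **U₃ on every X10b Heegner frame from the PINNED twins** (plan g9 rev-20 Sketch texts): A₃^pin
(Howard's containment `I(ℋ_F)² ≤ char(X_tors)` for a Heegner family `F` TIED to the frame's
parametrisation, `F.Dt = Dt`, on frames with `d_K ∉ {−3, −4}`) instantiated at the frame (`d_K ≠ −4` because
`d_K` is odd) feeds B₃^pin (the two-sided link `IMC ∘ Waldspurger` at `𝟙` granted that containment), of which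
the `≤` half is the one-sided link U₃ consumed by the upper-link road. Any class number.
[cite: Castella2018, Thm. 2.3 and §5 (eq:IMC+BDP) (arXiv:1704.06608 pp. 5, 12) (shape of both links)]
[cite: YanZhu2024MainConjNonCM, Thm. 5.9 (the Heegner-to-BDP transfer behind B₃^pin)] -/
theorem upperLink_of_pinnedTwins
    (hA3 : ∀ (W : WeierstrassCurve ℚ) [W.IsElliptic] [W.IsGloballyMinimal] (p : ℕ) [Fact p.Prime]
      [NeZero (W.conductorNorm ℤ)] (K : Type) [Field K] [NumberField K],
      Literature.NumberTheory.EllipticCurves.Rank1Residual.ClassX10 W p →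
      ¬ Literature.NumberTheory.EllipticCurves.Rank1Residual.Surj W 3 → ¬ W.HasCM →
      Literature.NumberTheory.EllipticCurves.IsImaginaryQuadratic K → NumberField.discr K ≠ -3 →
      NumberField.discr K ≠ -4 →
      Literature.NumberTheory.EllipticCurves.SatisfiesHeegnerHypothesis (W.conductorNorm ℤ) K →
      Literature.NumberTheory.EllipticCurves.SatisfiesHeegnerHypothesis p K →
      ∀ (κ : Literature.NumberTheory.EllipticCurves.ZpExtension K p), κ.IsAnticyclotomic →
      ∀ (γ : Field.absoluteGaloisGroup K), κ.IsTopGenerator γ →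
      ∀ (Dt : Literature.NumberTheory.EllipticCurves.ModularForms.ModularParametrizationData W
          (W.conductorNorm ℤ))
        (H : Literature.NumberTheory.EllipticCurves.HeegnerDatum (W.conductorNorm ℤ) (NumberField.discr K))
        (ιC : K →+* ℂ), ¬ (p : ℤ) ∣ Dt.c →
      ∃ (jbar : AlgebraicClosure K →+* ℂ) (D : (W.baseChange K).LambdaAdicSelmerData κ γ)
        (F : Literature.NumberTheory.EllipticCurves.HeegnerFamily (W.conductorNorm ℤ) W K κ jbar)
        (X : (W.baseChange K).SelmerDualData κ γ), F.Dt = Dt ∧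
        Literature.NumberTheory.EllipticCurves.heegnerCharIdeal D F ^ 2 ≤
          Literature.NumberTheory.EllipticCurves.Module.charIdeal
            (Literature.NumberTheory.EllipticCurves.IwasawaAlgebra p)
            (Submodule.torsion (Literature.NumberTheory.EllipticCurves.IwasawaAlgebra p) X.X))
    (hB3 : ∀ (W : WeierstrassCurve ℚ) [W.IsElliptic] [W.IsGloballyMinimal] (p : ℕ) [Fact p.Prime]
      [NeZero (W.conductorNorm ℤ)] (K : Type) [Field K] [NumberField K],
      Literature.NumberTheory.EllipticCurves.Rank1Residual.ClassX10 W p →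
      ¬ Literature.NumberTheory.EllipticCurves.Rank1Residual.Surj W 3 → ¬ W.HasCM →
      Literature.NumberTheory.EllipticCurves.IsImaginaryQuadratic K → Odd (NumberField.discr K) →
      NumberField.discr K ≠ -3 →
      Literature.NumberTheory.EllipticCurves.SatisfiesHeegnerHypothesis (W.conductorNorm ℤ) K →
      Literature.NumberTheory.EllipticCurves.SatisfiesHeegnerHypothesis p K →
      (W.baseChange K).HasIrreducibleModPGaloisRep p →
      ∀ (ι : K →+* ℚ_[p]) (κ : Literature.NumberTheory.EllipticCurves.ZpExtension K p), κ.IsAnticyclotomic →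
      ∀ (γ : Field.absoluteGaloisGroup K) [Fact (κ.IsTopGenerator γ)]
        (Dt : Literature.NumberTheory.EllipticCurves.ModularForms.ModularParametrizationData W
          (W.conductorNorm ℤ)), ¬ (p : ℤ) ∣ Dt.c →
      ∀ (H : Literature.NumberTheory.EllipticCurves.HeegnerDatum (W.conductorNorm ℤ) (NumberField.discr K))
        (ιC : K →+* ℂ) (P : (W.baseChange K).toAffine.Point),
        WeierstrassCurve.Affine.Point.map ιC.toRatAlgHom P =
          Literature.NumberTheory.EllipticCurves.ModularForms.heegnerPointComplex Dt H →
        (W.baseChange K).mordellWeilRank = 1 →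
        Finite (AddCommGroup.primaryComponent (W.baseChange K).sha p) → ¬ IsOfFinAddOrder P →
      (∃ (jbar : AlgebraicClosure K →+* ℂ) (D : (W.baseChange K).LambdaAdicSelmerData κ γ)
        (F : Literature.NumberTheory.EllipticCurves.HeegnerFamily (W.conductorNorm ℤ) W K κ jbar)
        (X : (W.baseChange K).SelmerDualData κ γ), F.Dt = Dt ∧
        Literature.NumberTheory.EllipticCurves.heegnerCharIdeal D F ^ 2 ≤
          Literature.NumberTheory.EllipticCurves.Module.charIdeal
            (Literature.NumberTheory.EllipticCurves.IwasawaAlgebra p)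
            (Submodule.torsion (Literature.NumberTheory.EllipticCurves.IwasawaAlgebra p) X.X)) →
      Summit.BirchSwinnertonDyer.Rank1Residual.X11b.IMCWaldspurgerOnTreeGoodAt p κ
        (Summit.BirchSwinnertonDyer.Rank1Residual.X11b.inducedPlace ι) γ ι P) :
    ∀ (W : WeierstrassCurve ℚ) [W.IsElliptic] [W.IsGloballyMinimal] (p : ℕ) [Fact p.Prime]
      [NeZero (W.conductorNorm ℤ)] (K : Type) [Field K] [NumberField K],
      Literature.NumberTheory.EllipticCurves.Rank1Residual.ClassX10 W p →
      ¬ Literature.NumberTheory.EllipticCurves.Rank1Residual.Surj W 3 → ¬ W.HasCM →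
      Literature.NumberTheory.EllipticCurves.IsImaginaryQuadratic K → Odd (NumberField.discr K) →
      NumberField.discr K ≠ -3 →
      Literature.NumberTheory.EllipticCurves.SatisfiesHeegnerHypothesis (W.conductorNorm ℤ) K →
      Literature.NumberTheory.EllipticCurves.SatisfiesHeegnerHypothesis p K →
      (W.baseChange K).HasIrreducibleModPGaloisRep p →
      ∀ (ι : K →+* ℚ_[p]) (κ : Literature.NumberTheory.EllipticCurves.ZpExtension K p), κ.IsAnticyclotomic →
      ∀ (γ : Field.absoluteGaloisGroup K) [Fact (κ.IsTopGenerator γ)]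
        (Dt : Literature.NumberTheory.EllipticCurves.ModularForms.ModularParametrizationData W
          (W.conductorNorm ℤ)), ¬ (p : ℤ) ∣ Dt.c →
      ∀ (H : Literature.NumberTheory.EllipticCurves.HeegnerDatum (W.conductorNorm ℤ) (NumberField.discr K))
        (ιC : K →+* ℂ) (P : (W.baseChange K).toAffine.Point),
        WeierstrassCurve.Affine.Point.map ιC.toRatAlgHom P =
          Literature.NumberTheory.EllipticCurves.ModularForms.heegnerPointComplex Dt H →
        (W.baseChange K).mordellWeilRank = 1 →
        Finite (AddCommGroup.primaryComponent (W.baseChange K).sha p) → ¬ IsOfFinAddOrder P →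
      ∃ n : ℕ, Summit.BirchSwinnertonDyer.Rank1Residual.X11b.AcSelmer.XAc.HasCharValuationAt
          (W.baseChange K) p κ (Summit.BirchSwinnertonDyer.Rank1Residual.X11b.inducedPlace ι) ∅ γ n ∧
        (n : ℤ) ≤ 2 * (Summit.BirchSwinnertonDyer.Rank1Residual.X11b.padicLogOrd W p ι P +
          (padicValInt p (1 - W.frobeniusTrace p + p) : ℤ) - 1) := by
  intro W _ _ p _ _ K _ _ hX hns hcm hK hodd h3 hHN hHp hirrK ι κ hκ γ _ Dt hc H ιC P hPt hrk hfinp hPinf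
  have h4 : NumberField.discr K ≠ -4 := by
    rintro h
    rw [h] at hodd
    exact absurd hodd (by decide)
  have hHow := hA3 W p K hX hns hcm hK h3 h4 hHN hHp κ hκ γ Fact.out Dt H ιC hc
  obtain ⟨n, hn, heq⟩ :=
    hB3 W p K hX hns hcm hK hodd h3 hHN hHp hirrK ι κ hκ γ Dt hc H ιC P hPt hrk hfinp hPinf hHow
  exact ⟨n, hn, le_of_eq heq⟩

/-- **U₃ on every X10b Heegner frame from the pinned twins, LIGHT A₃^pin** (x10b-p2 TURNKEY-2 text:
binders `Odd d_K`, (irr_K), rank one, `Ш[p^∞]` finite, as in PrintX9 rev 20a `HowardContainmentLightFramePinned`):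
same argument, every extra binder of A₃^pin is a binder of U₃. [cite: Castella2018, Thm. 2.3 and §5 (eq:IMC+BDP) (shape of both links)]
[cite: CastellaGrossiLeeSkinner2022, Thm. 4.1.1 (any class number, `E(K)[p] = 0`: the source of the LIGHT binders)] -/
theorem upperLink_of_pinnedTwinsLight
    (hA3 : ∀ (W : WeierstrassCurve ℚ) [W.IsElliptic] [W.IsGloballyMinimal] (p : ℕ) [Fact p.Prime]
      [NeZero (W.conductorNorm ℤ)] (K : Type) [Field K] [NumberField K],
      Literature.NumberTheory.EllipticCurves.Rank1Residual.ClassX10 W p →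
      ¬ Literature.NumberTheory.EllipticCurves.Rank1Residual.Surj W 3 → ¬ W.HasCM →
      Literature.NumberTheory.EllipticCurves.IsImaginaryQuadratic K → Odd (NumberField.discr K) →
      NumberField.discr K ≠ -3 →
      Literature.NumberTheory.EllipticCurves.SatisfiesHeegnerHypothesis (W.conductorNorm ℤ) K →
      Literature.NumberTheory.EllipticCurves.SatisfiesHeegnerHypothesis p K →
      (W.baseChange K).HasIrreducibleModPGaloisRep p →
      ∀ (κ : Literature.NumberTheory.EllipticCurves.ZpExtension K p), κ.IsAnticyclotomic →
      ∀ (γ : Field.absoluteGaloisGroup K), κ.IsTopGenerator γ →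
      ∀ (Dt : Literature.NumberTheory.EllipticCurves.ModularForms.ModularParametrizationData W
          (W.conductorNorm ℤ))
        (H : Literature.NumberTheory.EllipticCurves.HeegnerDatum (W.conductorNorm ℤ) (NumberField.discr K))
        (ιC : K →+* ℂ), ¬ (p : ℤ) ∣ Dt.c →
      (W.baseChange K).mordellWeilRank = 1 →
      Finite (AddCommGroup.primaryComponent (W.baseChange K).sha p) →
      ∃ (jbar : AlgebraicClosure K →+* ℂ) (D : (W.baseChange K).LambdaAdicSelmerData κ γ)
        (F : Literature.NumberTheory.EllipticCurves.HeegnerFamily (W.conductorNorm ℤ) W K κ jbar)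
        (X : (W.baseChange K).SelmerDualData κ γ), F.Dt = Dt ∧
        Literature.NumberTheory.EllipticCurves.heegnerCharIdeal D F ^ 2 ≤
          Literature.NumberTheory.EllipticCurves.Module.charIdeal
            (Literature.NumberTheory.EllipticCurves.IwasawaAlgebra p)
            (Submodule.torsion (Literature.NumberTheory.EllipticCurves.IwasawaAlgebra p) X.X))
    (hB3 : ∀ (W : WeierstrassCurve ℚ) [W.IsElliptic] [W.IsGloballyMinimal] (p : ℕ) [Fact p.Prime]
      [NeZero (W.conductorNorm ℤ)] (K : Type) [Field K] [NumberField K],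
      Literature.NumberTheory.EllipticCurves.Rank1Residual.ClassX10 W p →
      ¬ Literature.NumberTheory.EllipticCurves.Rank1Residual.Surj W 3 → ¬ W.HasCM →
      Literature.NumberTheory.EllipticCurves.IsImaginaryQuadratic K → Odd (NumberField.discr K) →
      NumberField.discr K ≠ -3 →
      Literature.NumberTheory.EllipticCurves.SatisfiesHeegnerHypothesis (W.conductorNorm ℤ) K →
      Literature.NumberTheory.EllipticCurves.SatisfiesHeegnerHypothesis p K →
      (W.baseChange K).HasIrreducibleModPGaloisRep p →
      ∀ (ι : K →+* ℚ_[p]) (κ : Literature.NumberTheory.EllipticCurves.ZpExtension K p), κ.IsAnticyclotomic →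
      ∀ (γ : Field.absoluteGaloisGroup K) [Fact (κ.IsTopGenerator γ)]
        (Dt : Literature.NumberTheory.EllipticCurves.ModularForms.ModularParametrizationData W
          (W.conductorNorm ℤ)), ¬ (p : ℤ) ∣ Dt.c →
      ∀ (H : Literature.NumberTheory.EllipticCurves.HeegnerDatum (W.conductorNorm ℤ) (NumberField.discr K))
        (ιC : K →+* ℂ) (P : (W.baseChange K).toAffine.Point),
        WeierstrassCurve.Affine.Point.map ιC.toRatAlgHom P =
          Literature.NumberTheory.EllipticCurves.ModularForms.heegnerPointComplex Dt H →
        (W.baseChange K).mordellWeilRank = 1 →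
        Finite (AddCommGroup.primaryComponent (W.baseChange K).sha p) → ¬ IsOfFinAddOrder P →
      (∃ (jbar : AlgebraicClosure K →+* ℂ) (D : (W.baseChange K).LambdaAdicSelmerData κ γ)
        (F : Literature.NumberTheory.EllipticCurves.HeegnerFamily (W.conductorNorm ℤ) W K κ jbar)
        (X : (W.baseChange K).SelmerDualData κ γ), F.Dt = Dt ∧
        Literature.NumberTheory.EllipticCurves.heegnerCharIdeal D F ^ 2 ≤
          Literature.NumberTheory.EllipticCurves.Module.charIdeal
            (Literature.NumberTheory.EllipticCurves.IwasawaAlgebra p)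
            (Submodule.torsion (Literature.NumberTheory.EllipticCurves.IwasawaAlgebra p) X.X)) →
      Summit.BirchSwinnertonDyer.Rank1Residual.X11b.IMCWaldspurgerOnTreeGoodAt p κ
        (Summit.BirchSwinnertonDyer.Rank1Residual.X11b.inducedPlace ι) γ ι P) :
    ∀ (W : WeierstrassCurve ℚ) [W.IsElliptic] [W.IsGloballyMinimal] (p : ℕ) [Fact p.Prime]
      [NeZero (W.conductorNorm ℤ)] (K : Type) [Field K] [NumberField K],
      Literature.NumberTheory.EllipticCurves.Rank1Residual.ClassX10 W p →
      ¬ Literature.NumberTheory.EllipticCurves.Rank1Residual.Surj W 3 → ¬ W.HasCM →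
      Literature.NumberTheory.EllipticCurves.IsImaginaryQuadratic K → Odd (NumberField.discr K) →
      NumberField.discr K ≠ -3 →
      Literature.NumberTheory.EllipticCurves.SatisfiesHeegnerHypothesis (W.conductorNorm ℤ) K →
      Literature.NumberTheory.EllipticCurves.SatisfiesHeegnerHypothesis p K →
      (W.baseChange K).HasIrreducibleModPGaloisRep p →
      ∀ (ι : K →+* ℚ_[p]) (κ : Literature.NumberTheory.EllipticCurves.ZpExtension K p), κ.IsAnticyclotomic →
      ∀ (γ : Field.absoluteGaloisGroup K) [Fact (κ.IsTopGenerator γ)]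
        (Dt : Literature.NumberTheory.EllipticCurves.ModularForms.ModularParametrizationData W
          (W.conductorNorm ℤ)), ¬ (p : ℤ) ∣ Dt.c →
      ∀ (H : Literature.NumberTheory.EllipticCurves.HeegnerDatum (W.conductorNorm ℤ) (NumberField.discr K))
        (ιC : K →+* ℂ) (P : (W.baseChange K).toAffine.Point),
        WeierstrassCurve.Affine.Point.map ιC.toRatAlgHom P =
          Literature.NumberTheory.EllipticCurves.ModularForms.heegnerPointComplex Dt H →
        (W.baseChange K).mordellWeilRank = 1 →
        Finite (AddCommGroup.primaryComponent (W.baseChange K).sha p) → ¬ IsOfFinAddOrder P →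
      ∃ n : ℕ, Summit.BirchSwinnertonDyer.Rank1Residual.X11b.AcSelmer.XAc.HasCharValuationAt
          (W.baseChange K) p κ (Summit.BirchSwinnertonDyer.Rank1Residual.X11b.inducedPlace ι) ∅ γ n ∧
        (n : ℤ) ≤ 2 * (Summit.BirchSwinnertonDyer.Rank1Residual.X11b.padicLogOrd W p ι P +
          (padicValInt p (1 - W.frobeniusTrace p + p) : ℤ) - 1) := by
  intro W _ _ p _ _ K _ _ hX hns hcm hK hodd h3 hHN hHp hirrK ι κ hκ γ _ Dt hc H ιC P hPt hrk hfinp hPinf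
  have hHow := hA3 W p K hX hns hcm hK hodd h3 hHN hHp hirrK κ hκ γ Fact.out Dt H ιC hc hrk hfinp
  obtain ⟨n, hn, heq⟩ :=
    hB3 W p K hX hns hcm hK hodd h3 hHN hHp hirrK ι κ hκ γ Dt hc H ιC P hPt hrk hfinp hPinf hHow
  exact ⟨n, hn, le_of_eq heq⟩

/-- **TURNKEY T-H (Sketch shape): the X10b leaf from the pinned twins and the route's bundles — NO J₃, NO
Cha Rmk. 25.** `AssemblyPinnedTwinsX10b` of plan g9's PrintX10b rev 20 with A₃^pin / B₃^pin unfolded: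
U₃ from the twins (`upperLink_of_pinnedTwins`) fed to the upper-link road
`bsdpOnClassX10b_of_upperLink_of_printFacts` (p608951). [cite: JetchevSkinnerWan2017, Thm. 3.3.1 and §7.4.1 (the road's rank-one descent)]
[cite: Cha2005, Rmk. 25 (p. 175) (NOT used — the point of this road)] -/
theorem bsdpOnClassX10b_of_pinnedTwins_of_printFacts
    (hA3 : ∀ (W : WeierstrassCurve ℚ) [W.IsElliptic] [W.IsGloballyMinimal] (p : ℕ) [Fact p.Prime]
      [NeZero (W.conductorNorm ℤ)] (K : Type) [Field K] [NumberField K],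
      Literature.NumberTheory.EllipticCurves.Rank1Residual.ClassX10 W p →
      ¬ Literature.NumberTheory.EllipticCurves.Rank1Residual.Surj W 3 → ¬ W.HasCM →
      Literature.NumberTheory.EllipticCurves.IsImaginaryQuadratic K → NumberField.discr K ≠ -3 →
      NumberField.discr K ≠ -4 →
      Literature.NumberTheory.EllipticCurves.SatisfiesHeegnerHypothesis (W.conductorNorm ℤ) K →
      Literature.NumberTheory.EllipticCurves.SatisfiesHeegnerHypothesis p K →
      ∀ (κ : Literature.NumberTheory.EllipticCurves.ZpExtension K p), κ.IsAnticyclotomic →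
      ∀ (γ : Field.absoluteGaloisGroup K), κ.IsTopGenerator γ →
      ∀ (Dt : Literature.NumberTheory.EllipticCurves.ModularForms.ModularParametrizationData W
          (W.conductorNorm ℤ))
        (H : Literature.NumberTheory.EllipticCurves.HeegnerDatum (W.conductorNorm ℤ) (NumberField.discr K))
        (ιC : K →+* ℂ), ¬ (p : ℤ) ∣ Dt.c →
      ∃ (jbar : AlgebraicClosure K →+* ℂ) (D : (W.baseChange K).LambdaAdicSelmerData κ γ)
        (F : Literature.NumberTheory.EllipticCurves.HeegnerFamily (W.conductorNorm ℤ) W K κ jbar)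
        (X : (W.baseChange K).SelmerDualData κ γ), F.Dt = Dt ∧
        Literature.NumberTheory.EllipticCurves.heegnerCharIdeal D F ^ 2 ≤
          Literature.NumberTheory.EllipticCurves.Module.charIdeal
            (Literature.NumberTheory.EllipticCurves.IwasawaAlgebra p)
            (Submodule.torsion (Literature.NumberTheory.EllipticCurves.IwasawaAlgebra p) X.X))
    (hB3 : ∀ (W : WeierstrassCurve ℚ) [W.IsElliptic] [W.IsGloballyMinimal] (p : ℕ) [Fact p.Prime]
      [NeZero (W.conductorNorm ℤ)] (K : Type) [Field K] [NumberField K],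
      Literature.NumberTheory.EllipticCurves.Rank1Residual.ClassX10 W p →
      ¬ Literature.NumberTheory.EllipticCurves.Rank1Residual.Surj W 3 → ¬ W.HasCM →
      Literature.NumberTheory.EllipticCurves.IsImaginaryQuadratic K → Odd (NumberField.discr K) →
      NumberField.discr K ≠ -3 →
      Literature.NumberTheory.EllipticCurves.SatisfiesHeegnerHypothesis (W.conductorNorm ℤ) K →
      Literature.NumberTheory.EllipticCurves.SatisfiesHeegnerHypothesis p K →
      (W.baseChange K).HasIrreducibleModPGaloisRep p →
      ∀ (ι : K →+* ℚ_[p]) (κ : Literature.NumberTheory.EllipticCurves.ZpExtension K p), κ.IsAnticyclotomic →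
      ∀ (γ : Field.absoluteGaloisGroup K) [Fact (κ.IsTopGenerator γ)]
        (Dt : Literature.NumberTheory.EllipticCurves.ModularForms.ModularParametrizationData W
          (W.conductorNorm ℤ)), ¬ (p : ℤ) ∣ Dt.c →
      ∀ (H : Literature.NumberTheory.EllipticCurves.HeegnerDatum (W.conductorNorm ℤ) (NumberField.discr K))
        (ιC : K →+* ℂ) (P : (W.baseChange K).toAffine.Point),
        WeierstrassCurve.Affine.Point.map ιC.toRatAlgHom P =
          Literature.NumberTheory.EllipticCurves.ModularForms.heegnerPointComplex Dt H →
        (W.baseChange K).mordellWeilRank = 1 →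
        Finite (AddCommGroup.primaryComponent (W.baseChange K).sha p) → ¬ IsOfFinAddOrder P →
      (∃ (jbar : AlgebraicClosure K →+* ℂ) (D : (W.baseChange K).LambdaAdicSelmerData κ γ)
        (F : Literature.NumberTheory.EllipticCurves.HeegnerFamily (W.conductorNorm ℤ) W K κ jbar)
        (X : (W.baseChange K).SelmerDualData κ γ), F.Dt = Dt ∧
        Literature.NumberTheory.EllipticCurves.heegnerCharIdeal D F ^ 2 ≤
          Literature.NumberTheory.EllipticCurves.Module.charIdeal
            (Literature.NumberTheory.EllipticCurves.IwasawaAlgebra p)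
            (Submodule.torsion (Literature.NumberTheory.EllipticCurves.IwasawaAlgebra p) X.X)) →
      Summit.BirchSwinnertonDyer.Rank1Residual.X11b.IMCWaldspurgerOnTreeGoodAt p κ
        (Summit.BirchSwinnertonDyer.Rank1Residual.X11b.inducedPlace ι) γ ι P)
    (hHP : HeegnerPrintFactsX10b) (hA : AnalyticMuZeroX10b) (hP : PrintFactsX10b) :
    Summit.BirchSwinnertonDyer.Rank1Residual.X10.BSDpOnClassX10b :=
  bsdpOnClassX10b_of_upperLink_of_printFacts (upperLink_of_pinnedTwins hA3 hB3) hA hHP hP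

/-- **TURNKEY T-H (LIGHT shape): the X10b leaf from the pinned twins with x10b-p2's LIGHT A₃^pin and the
route's bundles — NO J₃, NO Cha Rmk. 25.** [cite: JetchevSkinnerWan2017, Thm. 3.3.1 and §7.4.1 (the road's rank-one descent)]
[cite: Cha2005, Rmk. 25 (p. 175) (NOT used)] -/
theorem bsdpOnClassX10b_of_pinnedTwinsLight_of_printFacts
    (hA3 : ∀ (W : WeierstrassCurve ℚ) [W.IsElliptic] [W.IsGloballyMinimal] (p : ℕ) [Fact p.Prime]
      [NeZero (W.conductorNorm ℤ)] (K : Type) [Field K] [NumberField K],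
      Literature.NumberTheory.EllipticCurves.Rank1Residual.ClassX10 W p →
      ¬ Literature.NumberTheory.EllipticCurves.Rank1Residual.Surj W 3 → ¬ W.HasCM →
      Literature.NumberTheory.EllipticCurves.IsImaginaryQuadratic K → Odd (NumberField.discr K) →
      NumberField.discr K ≠ -3 →
      Literature.NumberTheory.EllipticCurves.SatisfiesHeegnerHypothesis (W.conductorNorm ℤ) K →
      Literature.NumberTheory.EllipticCurves.SatisfiesHeegnerHypothesis p K →
      (W.baseChange K).HasIrreducibleModPGaloisRep p →
      ∀ (κ : Literature.NumberTheory.EllipticCurves.ZpExtension K p), κ.IsAnticyclotomic →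
      ∀ (γ : Field.absoluteGaloisGroup K), κ.IsTopGenerator γ →
      ∀ (Dt : Literature.NumberTheory.EllipticCurves.ModularForms.ModularParametrizationData W
          (W.conductorNorm ℤ))
        (H : Literature.NumberTheory.EllipticCurves.HeegnerDatum (W.conductorNorm ℤ) (NumberField.discr K))
        (ιC : K →+* ℂ), ¬ (p : ℤ) ∣ Dt.c →
      (W.baseChange K).mordellWeilRank = 1 →
      Finite (AddCommGroup.primaryComponent (W.baseChange K).sha p) →
      ∃ (jbar : AlgebraicClosure K →+* ℂ) (D : (W.baseChange K).LambdaAdicSelmerData κ γ)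
        (F : Literature.NumberTheory.EllipticCurves.HeegnerFamily (W.conductorNorm ℤ) W K κ jbar)
        (X : (W.baseChange K).SelmerDualData κ γ), F.Dt = Dt ∧
        Literature.NumberTheory.EllipticCurves.heegnerCharIdeal D F ^ 2 ≤
          Literature.NumberTheory.EllipticCurves.Module.charIdeal
            (Literature.NumberTheory.EllipticCurves.IwasawaAlgebra p)
            (Submodule.torsion (Literature.NumberTheory.EllipticCurves.IwasawaAlgebra p) X.X))
    (hB3 : ∀ (W : WeierstrassCurve ℚ) [W.IsElliptic] [W.IsGloballyMinimal] (p : ℕ) [Fact p.Prime]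
      [NeZero (W.conductorNorm ℤ)] (K : Type) [Field K] [NumberField K],
      Literature.NumberTheory.EllipticCurves.Rank1Residual.ClassX10 W p →
      ¬ Literature.NumberTheory.EllipticCurves.Rank1Residual.Surj W 3 → ¬ W.HasCM →
      Literature.NumberTheory.EllipticCurves.IsImaginaryQuadratic K → Odd (NumberField.discr K) →
      NumberField.discr K ≠ -3 →
      Literature.NumberTheory.EllipticCurves.SatisfiesHeegnerHypothesis (W.conductorNorm ℤ) K →
      Literature.NumberTheory.EllipticCurves.SatisfiesHeegnerHypothesis p K →
      (W.baseChange K).HasIrreducibleModPGaloisRep p →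
      ∀ (ι : K →+* ℚ_[p]) (κ : Literature.NumberTheory.EllipticCurves.ZpExtension K p), κ.IsAnticyclotomic →
      ∀ (γ : Field.absoluteGaloisGroup K) [Fact (κ.IsTopGenerator γ)]
        (Dt : Literature.NumberTheory.EllipticCurves.ModularForms.ModularParametrizationData W
          (W.conductorNorm ℤ)), ¬ (p : ℤ) ∣ Dt.c →
      ∀ (H : Literature.NumberTheory.EllipticCurves.HeegnerDatum (W.conductorNorm ℤ) (NumberField.discr K))
        (ιC : K →+* ℂ) (P : (W.baseChange K).toAffine.Point),
        WeierstrassCurve.Affine.Point.map ιC.toRatAlgHom P =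
          Literature.NumberTheory.EllipticCurves.ModularForms.heegnerPointComplex Dt H →
        (W.baseChange K).mordellWeilRank = 1 →
        Finite (AddCommGroup.primaryComponent (W.baseChange K).sha p) → ¬ IsOfFinAddOrder P →
      (∃ (jbar : AlgebraicClosure K →+* ℂ) (D : (W.baseChange K).LambdaAdicSelmerData κ γ)
        (F : Literature.NumberTheory.EllipticCurves.HeegnerFamily (W.conductorNorm ℤ) W K κ jbar)
        (X : (W.baseChange K).SelmerDualData κ γ), F.Dt = Dt ∧
        Literature.NumberTheory.EllipticCurves.heegnerCharIdeal D F ^ 2 ≤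
          Literature.NumberTheory.EllipticCurves.Module.charIdeal
            (Literature.NumberTheory.EllipticCurves.IwasawaAlgebra p)
            (Submodule.torsion (Literature.NumberTheory.EllipticCurves.IwasawaAlgebra p) X.X)) →
      Summit.BirchSwinnertonDyer.Rank1Residual.X11b.IMCWaldspurgerOnTreeGoodAt p κ
        (Summit.BirchSwinnertonDyer.Rank1Residual.X11b.inducedPlace ι) γ ι P)
    (hHP : HeegnerPrintFactsX10b) (hA : AnalyticMuZeroX10b) (hP : PrintFactsX10b) :
    Summit.BirchSwinnertonDyer.Rank1Residual.X10.BSDpOnClassX10b :=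
  bsdpOnClassX10b_of_upperLink_of_printFacts (upperLink_of_pinnedTwinsLight hA3 hB3) hA hHP hP

end Summit.BirchSwinnertonDyer.Rank1Residual.X10

end
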